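import Summits.BirchSwinnertonDyer.Rank1Residual.X11b.RouteR1BaseSelmerCount
import Summits.BirchSwinnertonDyer.Rank1Residual.X11b.LocalTorsionAwayFromP
import Summits.BirchSwinnertonDyer.Rank1Residual.X11b.LocalTorsionTamagawa
import Summits.BirchSwinnertonDyer.Rank1Residual.X11b.BDPRouteRecord
import HarnessLib

/-!
# X11b at `p = 3` (team `x11b3`, N8/O2): the anticyclotomic CONTROL IDENTITY on tree objects at
# EVERY ODD PRIME — `p = 3` included — at route p2's Heegner data, on the locally-trivial
# sub-population (sub-target T2-CTL3)

HONEST FRAMING (cell `b2b-bsdres`, run/shared/lean/b2b/bsd-rank1-residual/, verbatim in every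
file): the goal of the cell is to DELETE the COMBINATION-SHAPED residual classes of the
Birch–Swinnerton-Dyer formula for ALL analytic-rank `≤ 1` elliptic curves over `ℚ` — "full BSD
formula for every rank `≤ 1` curve in class `C`" assembled STRICTLY from published theorems — so
that the rank-`≤ 1` remainder becomes exactly the CONSTRUCTION-SHAPED classes, which are TYPED
(missing-input `Prop`s), NOT attempted. This is not "finishing BSD". Team `x11b3` (coordinator
ruling 2026-08-21T04:04Z; STEP L at `p = 3`, `3 ‖ N`, `r = 1`, `E[3]` irreducible) is a RESEARCH
ROUTE; no claim beyond the stated class and sub-population; X11 ∧ `r = 1` at `p = 3` stays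
CONSTRUCTION-SHAPED / OPEN (RESIDUAL-MAP §I O2); nothing here changes a label; THEOREMS ONLY (no
definition, no named fact, no `sorry`); cell files `cells/x11b3/{PLAN,OWNERS,REFEREE}.md`.

## What this file proves, and why the team wants it
THE open input of class X11b at `p = 3` is `P2OpenInputOnTreeOddAt W 3` (`BDPRouteOpenInputOdd`,
multr1-p2); its TIGHTNESS (`P2.openInputOnTreeAt_iff_bsdp_of_locus`, `5 ≤ p`; odd-prime companion
`Three/OpenInputTight`, team sub-target T3, x11b3-p7) consumes the anticyclotomic CONTROL IDENTITY
— Castella, Camb. J. Math. 6 (2018) Thm. 2.3 = Jetchev–Skinner–Wan, Camb. J. Math. 5 (2017) Thm.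
3.3.1 read on the tree's objects, `ControlOnTreeAt p κ 𝔭 γ ι P` (`AnticyclotomicLogLinks`) — as a
HYPOTHESIS (PUB shape). Castella prints it under the standing hypotheses of his §2.1,
`paper:arxiv-1704.06608` p0005 L5: "Let $E/\bQ$ be a semistable elliptic curve of conductor $N$,
and let $p\geqslant 5$ be a prime such that the mod $p$ Galois representations … is irreducible";
JSW17 print the abstract control theorem for `p ≥ 3`, `paper:arxiv-1512.06894` p0006 L9:
"Throughout, let $p\geq 3$ be a fixed prime", §3.1 assumptions (sst), (τ-dual), (2-dim), (HT) "no
non-zero Hodge-Tate weight of $V$ is $\equiv 0\,(\mathrm{mod}\, {p-1})$" (true at `p = 3` for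
`T_p E`), (irred_K), (corank 1), (sur) — so `p = 3`, `V` semistable at `w ∣ p`, is INSIDE the
refereed statement; the cell never takes it as a fact but re-proves it on the constructed objects.
Route R1 (multr1-p1) proved the identity from two Poitou–Tate atoms (P6) ∧ (L10) where the local
kernels vanish (`controlOnTreeAt_of_two_atoms_of_noPTorsion`) and both atoms were then discharged
(`baseSelmerCountAt_of_rankOne`, multr1-p2 gen 19; `coinvariantsTrivialAt_of_erratum`) — but those
statements carry `ErratumHypotheses W p` (first conjunct `5 ≤ p`) and route R1's erratum-field data.
READING THE PROOFS: `5 ≤ p` enters ONLY through `p ≠ 2` (`ErratumHypotheses.two_ne`), `Mult`, `Irr`,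
the (ram) prime of the A′-locus and hypothesis (iv) `E(ℚ_p)[p] = 0`; every base lemma is
prime-free. This file re-assembles the chain with those five inputs as separate binders, at the
Heegner data of route p2 (imaginary quadratic `K`, EVERY `ℓ ∣ N_E` split), for EVERY prime `p ≠ 2`:

* §1 (iv) ⟹ `E(K̄)[p^∞]^{D_𝔭 ⊓ ker κ} = 0` at every degree-one `𝔭 ∣ p`; `s^{Σ(N⁺)}` bijective from
  `p ≠ 2`, `Irr`, `Ram`, (iv) (`controlMap_bijective_nPlus_of_irr_of_ram`).
* §2 `coinvariantsTrivialAt_of_noPTorsion` — (L10) JSW17 Lemma 3.3.3 on the constructed objects from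
  (iv), `K` imaginary quadratic with `p` split, `Sel_v(K,E[p^∞])` finite at `v ∣ p`, and the four
  CITED cohomological facts (Poitou–Tate ×2, local Euler characteristic, `cd_p ≤ 2`).
* §3 `controlOnTreeAt_of_two_atoms_of_noPTorsion_odd` — (P6) ∧ (L10) ∧ [`E(K_w)[p] = 0 ∧ p ∤ c_w` on
  `Σ(N⁺)`] ⟹ `ControlOnTreeAt`, binders (`p ≠ 2`, `Mult`, `Irr`, `Ram`, (iv)).
* §4 **`controlOnTreeAt_heegner_odd_of_facts`** — at an X11b-type pair (`p ≠ 2`, `mult(p)`, `irr(p)`)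
  with a (ram) prime, (iv), and `LocallyTrivialAt W p` (every bad `ℓ ≠ p`: `E(ℚ_ℓ)[p] = 0 ∧ p ∤ c_ℓ(E)`;
  numeric test `p ∤ c_ℓ(E)·#Ẽ_ns(𝔽_ℓ)`, `locallyTrivialAt_of_not_dvd` — "no bad `ℓ ≠ p` anomalous for
  `p`"), at EVERY imaginary quadratic Heegner field `K`, non-torsion Heegner point `P`, anticyclotomic
  `κ`, `γ`, degree-one `𝔭`: `ControlOnTreeAt p κ 𝔭 γ (embAt K p 𝔭) P` from Kolyvagin (named fact
  `kolyvagin`) and the four cited cohomological facts. NO typed input.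
* §5 class level — **`p2ControlOnTree_odd_of_locallyTrivial`**: on X11b ∧ (ram) ∧ `p ∤ ∏_ℓ c_ℓ(E)`
  ((iv) then automatic) ∧ `LocallyTrivialAt W p`, the ∀-data BODY of `P2ControlOnTreeAt W p` WITHOUT
  its antecedent `5 ≤ p` — verbatim the control hypothesis `hC` of `Three/OpenInputTight` — holds,
  every odd `p`. The companion `Three/OpenInputTightFacts` draws the consequences (`p = 3` rows,
  tightness with `hC` discharged, `Three.StepLAt W ↔ BSDp W 3` on the sub-population).

What this is NOT: not the open input (IMC≥)∘(BDP) at `3` (untouched; O2 stays OPEN); not a claim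
off the named sub-population (off `LocallyTrivialAt` the local-kernel atom (P11) is still typed, as
on route R1; off `p ∤ ∏c` the Tamagawa input (T2′) is); no label change; 0 facts minted.
CLASS-CLOSURE-PLAN §3.10 (E2): this is the kernel form of the "verbatim-extension" sub-class
'`3 ‖ N`, (ram) (⇒ surj(3)), `3 ∤ ∏c`, non-anomalous' for the ALGEBRAIC half of STEP L at 3.

References: [Castella2018] §2.1 (p. 5 L5), Thm. 2.3 (arXiv:1704.06608 p. 5); [JetchevSkinnerWan2017]
§2 (p. 6 L9), §3.1, Thm. 3.3.1, Prop. 3.2.1, Lemma 3.3.3, Prop. 3.3.4 (arXiv:1512.06894 pp. 10–14);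
[GreenbergLNM1716] §3 pp. 74–75, 85–90; [Castella2018Erratum] Thm. 1.1 (iv), Lemma 2.1;
[Kolyvagin1990] Thm. A; [Gross1991] Thm. 1.3; [MilneADT2006] I 2.8, I 4.10; [SerreGaloisCohomology] II §4.4 Prop. 13.
-/

noncomputable section

open scoped Classical

open WeierstrassCurve NumberField IsDedekindDomain Field
  Literature.NumberTheory.EllipticCurves Literature.NumberTheory.EllipticCurves.GreenbergSelmer
  Literature.NumberTheory.EllipticCurves.ModularForms Literature.NumberTheory.EllipticCurves.Rank1Residual
  Literature.NumberTheory.EllipticCurves.Rank1Residual.Typed Literature.NumberTheory.GaloisRepresentations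
  Literature.NumberTheory.GaloisCohomology Summit.BirchSwinnertonDyer.Rank1Residual.X11b.AcSelmer
  Summit.BirchSwinnertonDyer.Rank1Residual.X11b.LocBridge

namespace Summit.BirchSwinnertonDyer.Rank1Residual.X11b

/-! ## §1. The strict place and the bijection `s^{Σ(N⁺)}` from (`p ≠ 2`, `Irr`, `Ram`, (iv)) -/

section Strict

variable (W : WeierstrassCurve ℚ) [W.IsElliptic] [W.IsGloballyMinimal] (p : ℕ) [Fact p.Prime]

omit [W.IsGloballyMinimal] in
/-- **(iv) `E(ℚ_p)[p] = 0` gives `E(K̄)[p^∞]^{D_𝔭 ⊓ ker κ} = 0`** for EVERY number field `K`, EVERY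
degree-one `𝔭 ∣ p` (`K_𝔭 ≃ ℚ_p`) and EVERY `ℤ_p`-extension `κ` — route R1's
`fixedPoints_decomp_inf_kerSubgroup_eq_bot_of_aprimeLocusAt` with the A′-locus replaced by its second
clause alone (its proof never used the nonsplit prime). Any prime `p`.
[cite: Castella2018Erratum, Thm. 1.1 (iv), Remark (2), Lemma 2.1 (pp. 1–2)] -/
theorem AcSelmer.fixedPoints_decomp_inf_kerSubgroup_eq_bot_of_noPTorsion
    (h4 : ∀ R : (W.baseChange ℚ_[p]).toAffine.Point, p • R = 0 → R = 0)
    (K : Type) [Field K] [NumberField K] (κ : ZpExtension K p) (𝔭 : HeightOneSpectrum (𝓞 K))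
    (h𝔭 : ((p : ℕ) : 𝓞 K) ∈ 𝔭.asIdeal) (he : 𝔭.asIdeal.ramificationIdx (𝓞 ℚ) = 1)
    (hf : 𝔭.asIdeal.inertiaDeg (𝓞 ℚ) = 1) :
    FixedPoints.addSubgroup ↥(decomp 𝔭 ⊓ κ.kerSubgroup) ((W.baseChange K).geomPrimaryTorsion p) = ⊥ := by
  obtain ⟨e⟩ := exists_ringHom_adicCompletion_padic_of_degreeOne p 𝔭 h𝔭 he hf
  have hKv := noPTorsion_baseChange_adicCompletion_of_padic W p 𝔭 e h4
  exact fixedPoints_decomp_inf_kerSubgroup_eq_bot κ (W.baseChange K) 𝔭 fun m hfix hpm ↦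
    eq_zero_of_fixed_decomp_of_local (W.baseChange K) p 𝔭 hKv m hfix hpm

omit [W.IsGloballyMinimal] in
/-- **(iv) in local form**: at a degree-one `𝔭 ∣ p`, `E[p^∞]` has no non-zero `Γ_{K_𝔭}`-invariant
point (indeed none under `D_𝔭 ∩ ker κ`). Route R1's `ErratumHypotheses.noInvariantsAt` with (iv) as
the only input; any prime `p`. [cite: Castella2018Erratum, Thm. 1.1 (iv), Lemma 2.1 (pp. 1–2)] -/
theorem noInvariantsAt_of_noPTorsion
    (h4 : ∀ R : (W.baseChange ℚ_[p]).toAffine.Point, p • R = 0 → R = 0)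
    (K : Type) [Field K] [NumberField K] (κ : ZpExtension K p) (𝔭 : HeightOneSpectrum (𝓞 K))
    (h𝔭 : ((p : ℕ) : 𝓞 K) ∈ 𝔭.asIdeal) (he : 𝔭.asIdeal.ramificationIdx (𝓞 ℚ) = 1)
    (hf : 𝔭.asIdeal.inertiaDeg (𝓞 ℚ) = 1) (Q : (W.baseChange K).geomPrimaryTorsion p)
    (hQ : ∀ σ : absoluteGaloisGroup (𝔭.adicCompletion K),
      GaloisRep.restrictField (𝔭.adicCompletion K) (primaryGaloisModule (W.baseChange K) p) σ Q =
        Q) : Q = 0 := by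
  have h := AcSelmer.fixedPoints_decomp_inf_kerSubgroup_eq_bot_of_noPTorsion W p h4 K κ 𝔭 h𝔭 he hf
  have hmem : Q ∈ FixedPoints.addSubgroup ↥(decomp 𝔭 ⊓ κ.kerSubgroup)
      ((W.baseChange K).geomPrimaryTorsion p) := by
    refine (FixedPoints.mem_addSubgroup _ _ Q).mpr fun d ↦ ?_
    obtain ⟨σ, hσ⟩ := (mem_decomp_iff 𝔭 _).mp (Subgroup.mem_inf.mp d.2).1
    have h1 : absGaloisRestrict K (𝔭.adicCompletion K) σ • Q = Q := hQ σ
    rw [hσ] at h1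
    exact h1
  rw [h] at hmem
  exact (AddSubgroup.mem_bot).mp hmem

variable {W p}

/-- **The bijection `s : Sel_𝔭^{Σ(N⁺)}(K, E[p^∞]) → Sel_𝔭^{Σ(N⁺)}(K_∞, E[p^∞])^γ` from `p ≠ 2`, `Irr`,
a (ram) prime and (iv)** — route R1's `ErratumHypotheses.controlMap_bijective_nPlus` re-keyed to what
its proof consumed: injectivity by `Irr ∧ Ram` (`p ≠ 2`), the strict place by (iv), the away places
by Greenberg's Lemma 3.3 / complete splitting; `K` imaginary quadratic, `κ` anticyclotomic, `p ≠ 2`.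
[cite: JetchevSkinnerWan2017, §3.3 and Thm. 3.3.1 (arXiv:1512.06894 pp. 11–14) (shape only)] [cite: GreenbergLNM1716, §3 pp. 85–90] -/
theorem controlMap_bijective_nPlus_of_irr_of_ram (hp2 : p ≠ 2) (hirr : Irr W p) (hram : Ram W p)
    (h4 : ∀ R : (W.baseChange ℚ_[p]).toAffine.Point, p • R = 0 → R = 0)
    {K : Type} [Field K] [NumberField K] (hK : IsImaginaryQuadratic K) {κ : ZpExtension K p}
    (hκ : κ.IsAnticyclotomic) {γ : absoluteGaloisGroup K} (hγ : κ.IsTopGenerator γ)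
    (𝔭 : HeightOneSpectrum (𝓞 K)) (h𝔭 : ((p : ℕ) : 𝓞 K) ∈ 𝔭.asIdeal)
    (he : 𝔭.asIdeal.ramificationIdx (𝓞 ℚ) = 1) (hf : 𝔭.asIdeal.inertiaDeg (𝓞 ℚ) = 1) :
    Function.Bijective (controlMap (W.baseChange K) p κ 𝔭 (nPlusPlaces W K p) γ) := by
  haveI : IsTotallyComplex K := hK.2
  exact IsAnticyclotomic.controlMap_bijective_of_splitBad_subset (W.baseChange K) p κ 𝔭
    (nPlusPlaces W K p) hK.1 hκ hγ
    (resSubgroup_kerSubgroup_injective_of_irr_of_ram W p hp2 hirr hram K hK.1 κ)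
    (AcSelmer.fixedPoints_decomp_inf_kerSubgroup_eq_bot_of_noPTorsion W p h4 K κ 𝔭 h𝔭 he hf)
    (fun v hpv hbad he1 hf1 ↦ mem_nPlusPlaces_of v hpv
      (primesEquiv_under_dvd_conductorNorm_of_not_hasGoodReductionAt K v hbad) he1 hf1)

/-- **Exact control with no local defect, from (`p ≠ 2`, `Irr`, `Ram`, (iv))**: for `K` imaginary
quadratic, `κ` anticyclotomic with topological generator `γ`, `𝔭 ∣ p` of degree one, if
`E(K_w)[p] = 0` at every `w ∈ Σ(N⁺)` then `#Sel_𝔭(K_∞, E[p^∞])^γ = #Sel_𝔭(K, E[p^∞])`. Route R1's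
`ErratumHypotheses.natCard_endInvariants_empty_eq_natCard_base_of_noPTorsion`, re-keyed; any `p ≠ 2`.
[cite: GreenbergLNM1716, §3 Thm. 1.2 and pp. 74–75] [cite: JetchevSkinnerWan2017, §3.3.4 (arXiv:1512.06894 pp. 13–14)] -/
theorem natCard_endInvariants_empty_eq_natCard_base_of_noPTorsion_odd (hp2 : p ≠ 2)
    (hirr : Irr W p) (hram : Ram W p)
    (h4 : ∀ R : (W.baseChange ℚ_[p]).toAffine.Point, p • R = 0 → R = 0)
    {K : Type} [Field K] [NumberField K] (hK : IsImaginaryQuadratic K) {κ : ZpExtension K p}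
    (hκ : κ.IsAnticyclotomic) {γ : absoluteGaloisGroup K} (hγ : κ.IsTopGenerator γ)
    (𝔭 : HeightOneSpectrum (𝓞 K)) (h𝔭 : ((p : ℕ) : 𝓞 K) ∈ 𝔭.asIdeal)
    (he : 𝔭.asIdeal.ramificationIdx (𝓞 ℚ) = 1) (hf : 𝔭.asIdeal.inertiaDeg (𝓞 ℚ) = 1)
    (hloc : ∀ v ∈ nPlusPlaces W K p,
      ∀ R : ((W.baseChange K).baseChange (v.adicCompletion K)).toAffine.Point, p • R = 0 → R = 0) :
    Nat.card (IwasawaDual.endInvariants (conjSelmerAc (W.baseChange K) p κ 𝔭 ∅ γ - 1)) =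
      Nat.card (selmerAcBase (W.baseChange K) p 𝔭 ∅) :=
  haveI : (W.baseChange K).IsElliptic := by rw [baseChange]; infer_instance
  AcSelmer.natCard_endInvariants_empty_eq_of_localKer_eq_bot (nPlusPlaces_finite hK.1)
    (fun v hv ↦ ((mem_nPlusPlaces_iff v).mp hv).1) γ
    (controlMap_bijective_nPlus_of_irr_of_ram hp2 hirr hram h4 hK hκ hγ 𝔭 h𝔭 he hf)
    fun v hv ↦ AcSelmer.localKer_eq_bot_of_noPTorsion (W.baseChange K) p κ v (hloc v hv)

end Strict

/-! ## §2. (L10) `H¹_{ac}(K, M)_Γ = 0` on the constructed objects from (iv) and the cited facts -/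

section Coinvariants

variable (W : WeierstrassCurve ℚ) [W.IsElliptic] [W.IsGloballyMinimal] (p : ℕ) [Fact p.Prime]

/-- **(L10) JSW17 Lemma 3.3.3 on the constructed objects, (iv) as the only curve-side input**: for
`K` imaginary quadratic with `p` split, a `ℤ_p`-extension `κ` with topological generator `γ`, a
degree-one `𝔭 ∋ p`, and `Sel_v(K, E[p^∞])` finite at every `v ∣ p`: `CoinvariantsTrivialAt (E_K) p κ
𝔭 γ`, GIVEN the four cited cohomological facts (Poitou–Tate ×2, Milne I 4.10; local Euler–Poincaré
characteristic, Milne I 2.8; `cd_p(Γ_K) ≤ 2`, Serre II §4.4 Prop. 13). Route R1's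
`coinvariantsTrivialAt_of_erratum` with `ErratumHypotheses` / `IsErratumField` replaced by (iv),
`IsImaginaryQuadratic K`, `SplitsIn K p` — all its proof consumed; any prime `p`.
[cite: JetchevSkinnerWan2017, Lemma 3.3.3 (arXiv:1512.06894 pp. 11–12)] [cite: MilneADT2006, Ch. I, Thm. 4.10 and Thm. 2.8] -/
theorem coinvariantsTrivialAt_of_noPTorsion
    (h4 : ∀ R : (W.baseChange ℚ_[p]).toAffine.Point, p • R = 0 → R = 0)
    {K : Type} [Field K] [NumberField K]
    (hPT : poitouTate_selmerStructure_duality K) (hPT2 : poitouTate_sha_tateDual K)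
    (hEP : ∀ v : HeightOneSpectrum (𝓞 K), localEulerPoincareCharacteristic (v.adicCompletion K))
    (hcd : fieldCdLE_two_of_numberField) (hK : IsImaginaryQuadratic K) (hsplit : SplitsIn K p)
    (κ : ZpExtension K p) {γ : absoluteGaloisGroup K} (hγ : κ.IsTopGenerator γ)
    {𝔭 : HeightOneSpectrum (𝓞 K)} (h𝔭 : ((p : ℕ) : 𝓞 K) ∈ 𝔭.asIdeal)
    (he : 𝔭.asIdeal.ramificationIdx (𝓞 ℚ) = 1) (hf : 𝔭.asIdeal.inertiaDeg (𝓞 ℚ) = 1)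
    (hfin : ∀ v : HeightOneSpectrum (𝓞 K), ((p : ℕ) : 𝓞 K) ∈ v.asIdeal →
      Finite (selmerAcBase (W.baseChange K) p v ∅)) :
    CoinvariantsTrivialAt (W.baseChange K) p κ 𝔭 γ := by
  haveI : IsTotallyComplex K := hK.2
  obtain ⟨σ, 𝔮, -, hne, h𝔮, -⟩ :=
    LocalIndexTransport.exists_conj_prime_of_splitsIn K p hK.1 hsplit h𝔭
  have hΓ𝔭 := noInvariantsAt_of_noPTorsion W p h4 K κ 𝔭 h𝔭 he hf
  have hΓ := Coinv.noInvariants_of_noInvariants_at (W.baseChange K) p hΓ𝔭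
  have htor := exists_pow_nsmul_local_eq_zero W p hK.1 hsplit
  haveI := hfin 𝔭 h𝔭
  have h2 := WeakLeopoldt.subsingleton_galoisCohomology_two_primary (W.baseChange K) p 𝔭 ∅ hPT2
    (fieldCdLE_two_of_isTotallyComplex hcd K p) hΓ htor
  exact Coinv.coinvariantsTrivialAt_of_subsingleton (W.baseChange K) p κ hPT hEP h𝔭 h𝔮 hne hΓ𝔭
    (hfin 𝔮 h𝔮) h2 hγ

end Coinvariants

/-! ## §3. Cas18 Thm. 2.3 on the constructed objects from (P6) ∧ (L10), binders re-keyed -/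

section TwoAtoms

variable {W : WeierstrassCurve ℚ} [W.IsElliptic] [W.IsGloballyMinimal] {K : Type} [Field K]
  [NumberField K] {p : ℕ} [Fact p.Prime]

/-- **Cas18 Thm. 2.3 from (P6) ∧ (L10) alone where the local kernels vanish — EVERY `p ≠ 2`.** For
`p ≠ 2` multiplicative with `E[p]` irreducible, a (ram) prime and (iv); `K` imaginary quadratic with
`p` split, `κ` anticyclotomic with topological generator `γ`, a degree-one `𝔭 ∣ p`, any `ι`, `P`: if
at EVERY `w ∈ Σ(N⁺)` `E(K_w)[p] = 0` and `p ∤ c_w(E/K)`, then (P6) ∧ (L10) ⟹ `ControlOnTreeAt p κ 𝔭 γ ι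
P` (`ord_p f_ac(0) = log_p #Sel_𝔭(K, E[p^∞]) = a`, `ord_p ∏_{w∣N⁺} c_w = Σ_{w∣p} ord_p c_w`). Route R1's
`controlOnTreeAt_of_two_atoms_of_noPTorsion` VERBATIM with `ErratumHypotheses` replaced by
(`p ≠ 2`, `Mult`, `Irr`, `Ram`, (iv)). [cite: Castella2018, Thm. 2.3 (arXiv:1704.06608 p. 5)]
[cite: JetchevSkinnerWan2017, Thm. 3.3.1, Prop. 3.2.1, Lemma 3.3.3 (arXiv:1512.06894 pp. 10–12)] -/
theorem controlOnTreeAt_of_two_atoms_of_noPTorsion_odd (hp2 : p ≠ 2) (hmult : Mult W p)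
    (hirr : Irr W p) (hram : Ram W p)
    (h4 : ∀ R : (W.baseChange ℚ_[p]).toAffine.Point, p • R = 0 → R = 0)
    (hK : IsImaginaryQuadratic K) (hsplit : SplitsIn K p) {κ : ZpExtension K p}
    (hκ : κ.IsAnticyclotomic) (γ : absoluteGaloisGroup K) [hγ : Fact (κ.IsTopGenerator γ)]
    (𝔭 : HeightOneSpectrum (𝓞 K)) (h𝔭 : ((p : ℕ) : 𝓞 K) ∈ 𝔭.asIdeal)
    (he : 𝔭.asIdeal.ramificationIdx (𝓞 ℚ) = 1) (hf : 𝔭.asIdeal.inertiaDeg (𝓞 ℚ) = 1)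
    (ι : K →+* ℚ_[p]) (P : (W.baseChange K).toAffine.Point)
    (h6 : BaseSelmerCountAt p 𝔭 ι P) (h10 : CoinvariantsTrivialAt (W.baseChange K) p κ 𝔭 γ)
    (hloc : ∀ v ∈ nPlusPlaces W K p,
      (∀ R : ((W.baseChange K).baseChange (v.adicCompletion K)).toAffine.Point, p • R = 0 → R = 0) ∧
        ¬ p ∣ ((W.baseChange K).baseChange (v.adicCompletion K)).localTamagawaNumber
          (v.adicCompletionIntegers K)) :
    ControlOnTreeAt p κ 𝔭 γ ι P := by
  have hp : p.Prime := Fact.out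
  rw [controlOnTreeAt_iff_card p κ 𝔭 γ ι P]
  obtain ⟨a, ⟨_, hcardK⟩, ha⟩ := h6
  have hpN : p ∣ W.conductorNorm ℤ := dvd_conductorNorm_of_mult hmult
  have hcard := natCard_endInvariants_empty_eq_natCard_base_of_noPTorsion_odd hp2 hirr hram h4 hK hκ
    hγ.out 𝔭 h𝔭 he hf fun v hv ↦ (hloc v hv).1
  have hcoinv := natCard_endCoinvariants_eq_one_of_surjective _ h10
  -- the Tamagawa sum over `Σ(N⁺)` vanishes
  have hsum : (∑ v ∈ (nPlusPlaces_finite (W := W) (p := p) hK.1).toFinset, padicValNat p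
      (((W.baseChange K).baseChange (v.adicCompletion K)).localTamagawaNumber
        (v.adicCompletionIntegers K))) = 0 := by
    refine Finset.sum_eq_zero fun v hv ↦ ?_
    exact padicValNat.eq_zero_of_not_dvd
      (hloc v ((nPlusPlaces_finite (W := W) (p := p) hK.1).mem_toFinset.mp hv)).2
  refine ⟨a, ⟨?_, ?_⟩, ?_⟩
  · refine Nat.finite_of_card_ne_zero ?_
    rw [hcard, hcardK]
    exact pow_ne_zero _ hp.ne_zero
  · rw [hcard, hcardK, hcoinv, mul_one]
  · rw [ha, padicValNat_tamagawaProductSplit_eq_above_add_sum W p hK.1 hsplit hpN, hsum]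
    push_cast
    ring

end TwoAtoms

/-! ## §4. The control identity at a Heegner datum of route p2 from facts — every `p ≠ 2` -/

section HeegnerDatum

variable (W : WeierstrassCurve ℚ) [W.IsElliptic] [W.IsGloballyMinimal] (p : ℕ) [Fact p.Prime]

/-- **THE CONTROL IDENTITY ON TREE OBJECTS AT A HEEGNER DATUM, EVERY `p ≠ 2` (`p = 3` INCLUDED),
FROM FACTS.** For a globally minimal elliptic `W/ℚ` and a prime `p ≠ 2` of multiplicative reduction
with `E[p]` irreducible, a (ram) prime, hypothesis (iv) `E(ℚ_p)[p] = 0`, and `LocallyTrivialAt W p`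
(every bad `ℓ ≠ p`: `E(ℚ_ℓ)[p] = 0 ∧ p ∤ c_ℓ(E)`); for `K` imaginary quadratic with the Heegner
hypothesis for `N_E` (so `p` splits), a Heegner point `P ∈ E(K)` of level `N_E` of infinite order,
every anticyclotomic `κ`, topological generator `γ`, degree-one `𝔭 ∋ p`:
`ControlOnTreeAt p κ 𝔭 γ (embAt K p 𝔭) P` — Cas18 Thm. 2.3 / JSW17 Thm. 3.3.1 as an IDENTITY on the
constructed `X_ac(E[p^∞])` (`ord_p f(0) = ord_p #Ш(E/K)[p^∞] + 2((ord_p log_ω P − 1) −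
ord_p[E(K):ℤP]) + ord_p ∏_{w∣N⁺} c_w(E/K)`). Inputs: Kolyvagin (named fact `kolyvagin`: `rank E(K)
= 1`, `Ш(E/K)` finite) and the four CITED cohomological facts; (P6) by `baseSelmerCountAt_of_rankOne`
(at `𝔭` and `𝔭̄`), (L10) by §2, assembly by §3, side condition placed on `Σ(N⁺)` by
`locallyTrivial_nPlusPlaces`. NO typed input; no `5 ≤ p`.
[cite: Castella2018, Thm. 2.3 (arXiv:1704.06608 p. 5)] [cite: JetchevSkinnerWan2017, Thm. 3.3.1, Prop. 3.2.1, Lemma 3.3.3 (arXiv:1512.06894 pp. 10–12)]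
[cite: Kolyvagin1990, Thm. A] [cite: Gross1991, Thm. 1.3] [cite: MilneADT2006, Ch. I, Thm. 4.10 and Thm. 2.8] -/
theorem controlOnTreeAt_heegner_odd_of_facts
    (hKo : ∀ (N : ℕ) [NeZero N] (W : WeierstrassCurve ℚ) (K : Type) [Field K] [NumberField K],
      kolyvagin N W K)
    (hPT : ∀ (K : Type) [Field K] [NumberField K], poitouTate_selmerStructure_duality K)
    (hPT2 : ∀ (K : Type) [Field K] [NumberField K], poitouTate_sha_tateDual K)
    (hEP : ∀ (K : Type) [Field K] [NumberField K] (v : HeightOneSpectrum (𝓞 K)),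
      localEulerPoincareCharacteristic (v.adicCompletion K))
    (hcd : fieldCdLE_two_of_numberField)
    -- the pair: X11b-type, (ram), (iv), locally trivial away from `p`
    (hp2 : p ≠ 2) (hmult : Mult W p) (hirr : Irr W p) (hram : Ram W p)
    (h4 : ∀ R : (W.baseChange ℚ_[p]).toAffine.Point, p • R = 0 → R = 0)
    (hLT : LocallyTrivialAt W p)
    -- the Heegner datum
    {N : ℕ} [NeZero N] {K : Type} [Field K] [NumberField K]
    (Dt : ModularParametrizationData W N) (Hg : HeegnerDatum N (NumberField.discr K)) (ι : K →+* ℂ)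
    {P : (W.baseChange K).toAffine.Point}
    (hN : W.conductorNorm ℤ = N) (hK : IsImaginaryQuadratic K) (hHN : SatisfiesHeegnerHypothesis N K)
    (hP : WeierstrassCurve.Affine.Point.map ι.toRatAlgHom P = heegnerPointComplex Dt Hg)
    (hPinf : ¬ IsOfFinAddOrder P)
    {κ : ZpExtension K p} (hκ : κ.IsAnticyclotomic) (γ : Field.absoluteGaloisGroup K)
    [Fact (κ.IsTopGenerator γ)]
    (𝔭 : HeightOneSpectrum (𝓞 K)) (h𝔭 : ((p : ℕ) : 𝓞 K) ∈ 𝔭.asIdeal)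
    (he : 𝔭.asIdeal.ramificationIdx (𝓞 ℚ) = 1) (hf : 𝔭.asIdeal.inertiaDeg (𝓞 ℚ) = 1) :
    ControlOnTreeAt p κ 𝔭 γ (embAt K p 𝔭 h𝔭 he hf) P := by
  have hpN : p ∣ W.conductorNorm ℤ := dvd_conductorNorm_of_mult hmult
  have hsplit : SplitsIn K p := hHN p Fact.out (hN ▸ hpN)
  -- Kolyvagin: `rank E(K) = 1`, `Ш(E/K)` finite
  obtain ⟨hrank, hSha⟩ := hKo N W K hK hHN ⟨Dt, Hg, ι, hP⟩ hPinf
  -- (P6) at every `v ∣ p` (both of degree one since `p` splits), in particular at `𝔭`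
  have h6v : ∀ (v : HeightOneSpectrum (𝓞 K)) (hv : ((p : ℕ) : 𝓞 K) ∈ v.asIdeal),
      BaseSelmerCountAt p v (embAt K p v hv (degreeOne_of_splitsIn hK.1 hsplit hv).1
        (degreeOne_of_splitsIn hK.1 hsplit hv).2) P := fun v hv ↦
    baseSelmerCountAt_of_rankOne W p K (hPT K) (hEP K) hmult hirr hK hsplit h4 hrank hSha P hPinf v
      hv _ _
  have hfin : ∀ v : HeightOneSpectrum (𝓞 K), ((p : ℕ) : 𝓞 K) ∈ v.asIdeal →
      Finite (selmerAcBase (W.baseChange K) p v ∅) := fun v hv ↦ by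
    obtain ⟨a, ⟨hfinv, -⟩, -⟩ := h6v v hv
    exact hfinv
  have h6 : BaseSelmerCountAt p 𝔭 (embAt K p 𝔭 h𝔭 he hf) P :=
    baseSelmerCountAt_of_rankOne W p K (hPT K) (hEP K) hmult hirr hK hsplit h4 hrank hSha P hPinf 𝔭
      h𝔭 he hf
  -- (L10) from (iv) and the cited facts
  have h10 : CoinvariantsTrivialAt (W.baseChange K) p κ 𝔭 γ :=
    coinvariantsTrivialAt_of_noPTorsion W p h4 (hPT K) (hPT2 K) (hEP K) hcd hK hsplit κ
      (Fact.out : κ.IsTopGenerator γ) h𝔭 he hf hfin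
  exact controlOnTreeAt_of_two_atoms_of_noPTorsion_odd hp2 hmult hirr hram h4 hK hsplit hκ γ 𝔭 h𝔭
    he hf (embAt K p 𝔭 h𝔭 he hf) P h6 h10 fun v hv ↦ locallyTrivial_nPlusPlaces (K := K) hLT hv

/-! ## §5. Class level: route p2's control hypothesis WITHOUT `5 ≤ p`, on the named sub-population -/

/-- **Route p2's control hypothesis at EVERY ODD PRIME on X11b ∧ (ram) ∧ `p ∤ ∏c` ∧ locally-trivial —
a THEOREM modulo Kolyvagin and the four cited cohomological facts.** The ∀-data BODY of multr1-p2's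
`P2ControlOnTreeAt W p` (`BDPRouteRecord`) with its antecedent `5 ≤ p` REMOVED — verbatim the
quantifier prefix of `P2OpenInputOnTreeOddAt W p` (`BDPRouteOpenInputOdd`), concluding
`ControlOnTreeAt p κ 𝔭 γ (embAt K p 𝔭) P` — holds for a globally minimal elliptic `W/ℚ` and a prime
`p` with `(E,p) ∈` X11b (`r_an = 1`, `p ≠ 2`, `mult(p)`, `irr(p)`), a (ram) prime, `p ∤ ∏_ℓ c_ℓ(E)`
and `LocallyTrivialAt W p`. (Several antecedents of the body — `Surj`, `d_K` odd, `p ∤ d_K`,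
`p ∤ #𝓞_K^×`, `L(E^{d_K},1) ≠ 0`, `p ∤ c` — are not used.) (iv) is supplied by `p ∤ ∏ c`
(`LocalTorsion.localTorsion_eq_zero_of_not_dvd_tamagawaProduct`, `p ≥ 3`), the rest is §4. This is
the control-identity hypothesis `hC` of the odd-prime tightness of THE open input
(`Three/OpenInputTight`, team sub-target T3) discharged on the named sub-population, `p = 3`
included. CONDITIONAL on the named/cited facts only; nothing booked; O2 stays OPEN (the open input
itself is untouched). [cite: Castella2018, Thm. 2.3 (arXiv:1704.06608 p. 5)]
[cite: JetchevSkinnerWan2017, Thm. 3.3.1, Prop. 3.2.1, Lemma 3.3.3 (arXiv:1512.06894 pp. 10–12)]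
[cite: SilvermanATAEC1994, Cor. IV.9.2(d) with (b) (PDF p. 340)]
[cite: Kolyvagin1990, Thm. A] [cite: MilneADT2006, Ch. I, Thm. 4.10 and Thm. 2.8] -/
theorem p2ControlOnTree_odd_of_locallyTrivial
    (hKo : ∀ (N : ℕ) [NeZero N] (W : WeierstrassCurve ℚ) (K : Type) [Field K] [NumberField K],
      kolyvagin N W K)
    (hPT : ∀ (K : Type) [Field K] [NumberField K], poitouTate_selmerStructure_duality K)
    (hPT2 : ∀ (K : Type) [Field K] [NumberField K], poitouTate_sha_tateDual K)
    (hEP : ∀ (K : Type) [Field K] [NumberField K] (v : HeightOneSpectrum (𝓞 K)),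
      localEulerPoincareCharacteristic (v.adicCompletion K))
    (hcd : fieldCdLE_two_of_numberField)
    (hX : ClassX11b W p) (hram : Ram W p) (htam : ¬ p ∣ W.tamagawaProduct)
    (hLT : LocallyTrivialAt W p) :
    ∀ (N : ℕ) [NeZero N] (K : Type) [Field K] [NumberField K]
      (Dt : ModularParametrizationData W N) (H : HeegnerDatum N (NumberField.discr K)) (ι : K →+* ℂ)
      (P : (W.baseChange K).toAffine.Point),
      ClassX11b W p → Surj W p → W.conductorNorm ℤ = N → IsImaginaryQuadratic K →
      Odd (NumberField.discr K) → ¬ (p : ℤ) ∣ NumberField.discr K → ¬ p ∣ Units.torsionOrder K →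
      SatisfiesHeegnerHypothesis N K →
      (W.quadraticTwist (NumberField.discr K : ℚ)).entireLFunction 1 ≠ 0 →
      WeierstrassCurve.Affine.Point.map ι.toRatAlgHom P = heegnerPointComplex Dt H →
      ¬ (p : ℤ) ∣ Dt.c → ¬ IsOfFinAddOrder P →
      ∀ (κ : ZpExtension K p), κ.IsAnticyclotomic →
        ∀ (γ : Field.absoluteGaloisGroup K) [Fact (κ.IsTopGenerator γ)]
          (𝔭 : HeightOneSpectrum (𝓞 K)) (h𝔭 : ((p : ℕ) : 𝓞 K) ∈ 𝔭.asIdeal)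
          (he : 𝔭.asIdeal.ramificationIdx (𝓞 ℚ) = 1) (hf : 𝔭.asIdeal.inertiaDeg (𝓞 ℚ) = 1),
          ControlOnTreeAt p κ 𝔭 γ (embAt K p 𝔭 h𝔭 he hf) P := by
  intro N _ K _ _ Dt H ι P _ _ hN hK _ _ _ hHN _ hP _ hPinf κ hκ γ _ 𝔭 h𝔭 he hf
  obtain ⟨-, hp2, hmult, hirr⟩ := hX
  have hp3 : 3 ≤ p := by
    have := (Fact.out : p.Prime).two_le
    omega
  exact controlOnTreeAt_heegner_odd_of_facts W p hKo hPT hPT2 hEP hcd hp2 hmult hirr hram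
    (LocalTorsion.localTorsion_eq_zero_of_not_dvd_tamagawaProduct W p hp3 hmult htam) hLT Dt H ι hN
    hK hHN hP hPinf hκ γ 𝔭 h𝔭 he hf

end HeegnerDatum

end Summit.BirchSwinnertonDyer.Rank1Residual.X11b

end
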